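import Summits.HubbardSuperconductivity.HubbardSuperconductivity.Theorems.ThermalWedgeTwSeededEnsembleEquivalenceRFreeAnomalousFormula

/-!
# Crux `TwSeededEnsembleEquivalenceR` (stmt-HubbardSuperconductivity-15581), line `cold-floor-collapse` (slug `Sketch`),
# skeleton v10 — the FREE ANOMALOUS MARGIN: the `U = 0` signal of DEEP-SIGN is `≥ c·L²/β`, uniformly in `L`

Support file (`--supports stmt-HubbardSuperconductivity-15581`; sorry-free; no definition; route-file free).

`…RFreeAnomalousFormula.lean` computes the free truncated anomalous `d`-wave pair correlator of the sourced torus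
in closed form, `(Re⟨Δ_d⟩)² − Re(Δ_d,Δ_d)_{Duh} = (128h²/β²) Σ_k ĝ_d(k)⁴ Σₙ (ωₙ² + E_k²)⁻²`. This file bounds it
BELOW, quantitatively and uniformly in the volume (`fam_freeAnomalousMargin`): for every window
`-4 < μ₁ < μ₂ < 0` there is `c > 0` such that for every `h₀ > 0`, eventually in `L`, for all `β > 0`,
`μ ∈ [μ₁, μ₂]`, `h ∈ [h₀, 3]` with `βh ≥ 4π`,

  `c · L²/β ≤ (Re⟨Δ_d⟩)² − Re (Δ_d,Δ_d)_{Duh; β, dWaveSourceTorus L 0 μ h}`.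

This is the quantitative form of the `U = 0` calibration `cal_freeAnomalousSign_finiteVolume` (which gives only
the sign): in the Ward currency `χ⊥ − χ∥ = (4β/L²)·[(Re⟨Δ⟩)² − Re(Δ,Δ)] ≥ 4c`, an `h`-INDEPENDENT gap between the
transverse and the longitudinal pair susceptibility of the free BdG gas at every deep source `T ≪ h ≤ 3` — the
signal an interacting remainder `O(a)` has to stay below (`…RFreeAnomalousReduction.lean`). Ingredients:
* `fam_matsubara_S2_lower` — `Σₙ (ωₙ² + E²)⁻² ≥ β/(16πE³)` for `βE ≥ 4π` (the first `⌊βE/2π⌋` frequencies);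
* `fam_card_grid_Icc`, `fam_card_cos_Icc` — at least `(b−a)L/(2π) − 1` lattice angles `2πj/L` have
  `cos(2πj/L) ∈ [a, b] ⊂ [−1, 1]` (`arccos` is `1`-expanding, floor/ceiling count);
* the ANTINODAL SHELL: with `t = −μ/2`, `γ = 1 + μ₁/4`, the lattice momenta with `cos k₁ ≈ ½ + t/4` (within `γ/8`)
  and `cos k₂ ≈ t − cos k₁` (within `min(h,γ)/4`) number `≥ γ·min(h,γ)·L²/(128π²)`, and carry `|ξ_k| ≤ h/2`,
  `ĝ_d(k) ≥ γ/2`, `E_k ≤ 6h`, hence each contributes `≥ (γ/2)⁴·β/(16π(6h)³)` to the double sum; the factors of `h`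
  cancel (`h²·h·h⁻³`), which is why the margin does not degrade at deep sources.
[folklore: the BdG transverse-minus-longitudinal pair susceptibility is of order `N(0)` at `T ≪ h`]
-/

set_option linter.dupNamespace false

noncomputable section

namespace Summit.HubbardSuperconductivity.HubbardSuperconductivity.Theorems.TwSeededEnsembleEquivalenceR

open Real Set Matrix Finset Filter Literature.MathematicalPhysics.QuantumLattice Literature.Probability.LatticeModels
  Literature.Analysis.SpecialFunctions
open scoped ComplexOrder Topology

/-! ### The Matsubara sum `S₂(E²)` is at least `β/(16πE³)` for `βE ≥ 4π` -/

/-- **Lower bound for `S₂`**: for `β, E > 0` with `βE ≥ 4π`, `β/(16πE³) ≤ Σₙ 1/(ωₙ² + E²)²` — keep the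
`N = ⌊βE/(2π)⌋ ≥ βE/(4π)` frequencies below `E`, each contributing at least `1/(4E⁴)`. [folklore] -/
theorem fam_matsubara_S2_lower {β E : ℝ} (hβ : 0 < β) (hE : 0 < E) (hβE : 4 * π ≤ β * E) :
    β / (16 * π * E ^ 3) ≤ ∑' n : ℕ, 1 / (((2 * n + 1) * π / β) ^ 2 + E ^ 2) ^ 2 := by
  have hπ := Real.pi_pos
  set x : ℝ := β * E / (2 * π) with hx_def
  have hx2 : 2 ≤ x := by
    rw [hx_def, le_div_iff₀ (by positivity)]; linarith
  have hx0 : 0 ≤ x := by linarith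
  set N : ℕ := ⌊x⌋₊ with hN_def
  have hNle : (N : ℝ) ≤ x := Nat.floor_le hx0
  have hNgt : x < N + 1 := Nat.lt_floor_add_one x
  have hNge : x / 2 ≤ N := by linarith
  -- each of the first `N` terms is at least `1/(4E⁴)`
  have hterm : ∀ n ∈ Finset.range N, 1 / (4 * E ^ 4) ≤ 1 / (((2 * n + 1) * π / β) ^ 2 + E ^ 2) ^ 2 := by
    intro n hn
    rw [Finset.mem_range] at hn
    have hn1 : (n : ℝ) + 1 ≤ N := by exact_mod_cast hn
    have hω : (2 * n + 1) * π / β ≤ E := by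
      rw [div_le_iff₀ hβ]
      have h1 : (2 * (n : ℝ) + 1) ≤ 2 * x := by linarith
      have h2 : 2 * x * π = β * E := by rw [hx_def]; field_simp
      nlinarith
    have hω0 : 0 ≤ (2 * n + 1) * π / β := by positivity
    have hsq : ((2 * n + 1) * π / β) ^ 2 ≤ E ^ 2 := pow_le_pow_left₀ hω0 hω 2
    have hden : (((2 * n + 1) * π / β) ^ 2 + E ^ 2) ^ 2 ≤ 4 * E ^ 4 := by nlinarith [sq_nonneg E]
    have hpos : 0 < (((2 * n + 1) * π / β) ^ 2 + E ^ 2) ^ 2 := by positivity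
    exact one_div_le_one_div_of_le hpos hden
  have hsum : ∑ n ∈ Finset.range N, 1 / (4 * E ^ 4) ≤
      ∑ n ∈ Finset.range N, 1 / (((2 * n + 1) * π / β) ^ 2 + E ^ 2) ^ 2 := Finset.sum_le_sum hterm
  have hle : ∑ n ∈ Finset.range N, 1 / (((2 * n + 1) * π / β) ^ 2 + E ^ 2) ^ 2 ≤
      ∑' n : ℕ, 1 / (((2 * n + 1) * π / β) ^ 2 + E ^ 2) ^ 2 :=
    (fam_summable_S2 hβ (sq_nonneg E)).sum_le_tsum (Finset.range N) fun n _ => by positivity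
  rw [Finset.sum_const, Finset.card_range, nsmul_eq_mul] at hsum
  calc β / (16 * π * E ^ 3) = x / 2 * (1 / (4 * E ^ 4)) := by rw [hx_def]; field_simp; ring
    _ ≤ N * (1 / (4 * E ^ 4)) := by gcongr
    _ ≤ _ := hsum.trans hle

/-! ### Counting lattice angles -/

/-- **Lattice angles in an interval**: for `0 ≤ u ≤ v ≤ π` at least `(v − u)L/(2π) − 1` of the angles `2πj/L`,
`j < L`, lie in `[u, v]` (all `j` between `⌈uL/2π⌉` and `⌊vL/2π⌋`). [folklore] -/
theorem fam_card_grid_Icc {L : ℕ} (hL : 0 < L) {u v : ℝ} (hu : 0 ≤ u) (huv : u ≤ v) (hv : v ≤ π) :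
    (v - u) * L / (2 * π) - 1 ≤
      (((Finset.range L).filter fun j : ℕ => u ≤ 2 * π * j / L ∧ 2 * π * j / L ≤ v).card : ℝ) := by
  have hπ := Real.pi_pos
  have hL' : (0 : ℝ) < L := by exact_mod_cast hL
  set c : ℝ := L / (2 * π) with hc_def
  have hc : 0 < c := by positivity
  have hangle : ∀ j : ℕ, 2 * π * j / L = j / c := fun j => by rw [hc_def]; field_simp
  set j₀ : ℕ := ⌈u * c⌉₊ with hj₀
  set j₁ : ℕ := ⌊v * c⌋₊ with hj₁
  have huc : 0 ≤ u * c := by positivity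
  have hv0 : 0 ≤ v := hu.trans huv
  have hvc : 0 ≤ v * c := by positivity
  have hsub : Finset.Icc j₀ j₁ ⊆ (Finset.range L).filter fun j : ℕ => u ≤ 2 * π * j / L ∧ 2 * π * j / L ≤ v := by
    intro j hj
    rw [Finset.mem_Icc] at hj
    have h0 : u * c ≤ j := (Nat.le_ceil (u * c)).trans (by exact_mod_cast hj.1)
    have h1 : (j : ℝ) ≤ v * c := (show (j : ℝ) ≤ j₁ by exact_mod_cast hj.2).trans (Nat.floor_le hvc)
    rw [Finset.mem_filter, Finset.mem_range, hangle]
    refine ⟨?_, ?_, ?_⟩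
    · have hjlt : (j : ℝ) < L := by
        have : v * c ≤ π * c := by gcongr
        have hπc : π * c = L / 2 := by rw [hc_def]; field_simp
        linarith
      exact_mod_cast hjlt
    · rwa [le_div_iff₀ hc]
    · rwa [div_le_iff₀ hc]
  have hcard := Finset.card_le_card hsub
  rw [Nat.card_Icc] at hcard
  have hj₀lt : (j₀ : ℝ) < u * c + 1 := Nat.ceil_lt_add_one huc
  have hj₁gt : v * c < j₁ + 1 := Nat.lt_floor_add_one _
  have hreal : (v - u) * L / (2 * π) - 1 ≤ (j₁ : ℝ) + 1 - j₀ := by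
    have : (v - u) * L / (2 * π) = v * c - u * c := by rw [hc_def]; ring
    linarith
  refine hreal.trans ?_
  by_cases hle : j₀ ≤ j₁ + 1
  · have : ((j₁ + 1 - j₀ : ℕ) : ℝ) = (j₁ : ℝ) + 1 - j₀ := by push_cast [Nat.cast_sub hle]; ring
    rw [← this]
    exact_mod_cast hcard
  · push Not at hle
    have h1 : (j₁ : ℝ) + 1 < j₀ := by exact_mod_cast hle
    have h2 : (0 : ℝ) ≤ (((Finset.range L).filter fun j : ℕ => u ≤ 2 * π * j / L ∧ 2 * π * j / L ≤ v).card : ℝ) :=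
      Nat.cast_nonneg _
    linarith

/-- **Lattice angles with cosine in an interval**: for `−1 ≤ a ≤ b ≤ 1` at least `(b − a)L/(2π) − 1` of the
`j < L` have `cos(2πj/L) ∈ [a, b]` (the arc `[arccos b, arccos a]` has length `≥ b − a` since `cos` is
`1`-Lipschitz). [folklore] -/
theorem fam_card_cos_Icc {L : ℕ} (hL : 0 < L) {a b : ℝ} (ha : -1 ≤ a) (hab : a ≤ b) (hb : b ≤ 1) :
    (b - a) * L / (2 * π) - 1 ≤
      (((Finset.range L).filter fun j : ℕ => a ≤ Real.cos (2 * π * j / L) ∧ Real.cos (2 * π * j / L) ≤ b).card : ℝ) := by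
  have hπ := Real.pi_pos
  have hL' : (0 : ℝ) < L := by exact_mod_cast hL
  set u := Real.arccos b with hu
  set v := Real.arccos a with hv
  have hu0 : 0 ≤ u := Real.arccos_nonneg b
  have huv : u ≤ v := Real.arccos_le_arccos hab
  have hvπ : v ≤ π := Real.arccos_le_pi a
  have hcb : Real.cos u = b := Real.cos_arccos (by linarith) hb
  have hca : Real.cos v = a := Real.cos_arccos ha (by linarith)
  have hlen : b - a ≤ v - u := by
    have h := Real.abs_cos_sub_cos_le u v
    rw [hcb, hca, abs_of_nonneg (by linarith), abs_of_nonpos (by linarith)] at h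
    linarith
  have hsub : ((Finset.range L).filter fun j : ℕ => u ≤ 2 * π * j / L ∧ 2 * π * j / L ≤ v) ⊆
      (Finset.range L).filter fun j : ℕ => a ≤ Real.cos (2 * π * j / L) ∧ Real.cos (2 * π * j / L) ≤ b := by
    intro j hj
    rw [Finset.mem_filter] at hj ⊢
    refine ⟨hj.1, ?_, ?_⟩
    · rw [← hca]
      exact Real.cos_le_cos_of_nonneg_of_le_pi (hu0.trans hj.2.1) hvπ hj.2.2
    · rw [← hcb]
      exact Real.cos_le_cos_of_nonneg_of_le_pi hu0 (hj.2.2.trans hvπ) hj.2.1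
  have hcard := Finset.card_le_card hsub
  have h1 := fam_card_grid_Icc hL hu0 huv hvπ
  calc (b - a) * L / (2 * π) - 1 ≤ (v - u) * L / (2 * π) - 1 := by gcongr
    _ ≤ _ := h1
    _ ≤ _ := by exact_mod_cast hcard

/-! ### The double sum over the torus momenta, the antinodal shell, and the margin -/

/-- The mode sum over the torus momenta is a double `range` sum of an explicit function of the two angles
`2πi/L`, `2πj/L`. [folklore] -/
theorem fam_doubleSum_eq {L : ℕ} [NeZero L] (β μ h : ℝ) :
    ∑ k : TorusSite 2 L, dWaveGap k ^ 4 *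
        ∑' n : ℕ, 1 / (((2 * n + 1) * π / β) ^ 2 + ((torusBand L k - μ) ^ 2 + 8 * dWaveGap k ^ 2 * h ^ 2)) ^ 2 =
      ∑ i ∈ Finset.range L, ∑ j ∈ Finset.range L,
        (Real.cos (2 * π * i / L) - Real.cos (2 * π * j / L)) ^ 4 *
          ∑' n : ℕ, 1 / (((2 * n + 1) * π / β) ^ 2 +
            ((-2 * (Real.cos (2 * π * i / L) + Real.cos (2 * π * j / L)) - μ) ^ 2 +
              8 * (Real.cos (2 * π * i / L) - Real.cos (2 * π * j / L)) ^ 2 * h ^ 2)) ^ 2 := by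
  rw [← twR_sum_torusSite_eq_sum_range (L := L) (fun i j : ℕ =>
    (Real.cos (2 * π * i / L) - Real.cos (2 * π * j / L)) ^ 4 *
      ∑' n : ℕ, 1 / (((2 * n + 1) * π / β) ^ 2 +
        ((-2 * (Real.cos (2 * π * i / L) + Real.cos (2 * π * j / L)) - μ) ^ 2 +
          8 * (Real.cos (2 * π * i / L) - Real.cos (2 * π * j / L)) ^ 2 * h ^ 2)) ^ 2)]
  refine Finset.sum_congr rfl fun k _ => ?_
  obtain ⟨hb, hg⟩ := twR_torusBand_dWaveGap_eq (L := L) k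
  rw [hb, hg]

/-- **A shell momentum contributes at least `(γ/2)⁴·β/(16π(6h)³)`.** If `a = cos k₁` is within `γ/8` of
`½ − μ/8` and `b = cos k₂` within `δ₂ ≤ min(h,γ)/4` of `−μ/2 − a` (so `|ξ_k| ≤ h/2`, `ĝ_d(k) = a − b ≥ γ/2`,
`E_k ≤ 6h`), then `ĝ_d⁴ · S₂(E_k²) ≥ (γ/2)⁴ · S₂((6h)²) ≥ (γ/2)⁴ β/(16π(6h)³)` for `βh ≥ 4π`. [folklore] -/
theorem fam_boxTerm_lower {β h γ μ a b δ₂ : ℝ} (hβ : 0 < β) (hh : 0 < h) (hβh : 4 * π ≤ β * h) (hγ : 0 < γ)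
    (hγμ : γ ≤ 1 + μ / 4) (hδ₂h : δ₂ ≤ h / 4) (hδ₂γ : δ₂ ≤ γ / 4)
    (hA : |a - (1 / 2 - μ / 8)| ≤ γ / 8) (hB : |b - (-μ / 2 - a)| ≤ δ₂) (ha1 : |a| ≤ 1) (hb1 : |b| ≤ 1) :
    (γ / 2) ^ 4 * (β / (16 * π * (6 * h) ^ 3)) ≤
      (a - b) ^ 4 * ∑' n : ℕ, 1 / (((2 * n + 1) * π / β) ^ 2 +
        ((-2 * (a + b) - μ) ^ 2 + 8 * (a - b) ^ 2 * h ^ 2)) ^ 2 := by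
  have hπ := Real.pi_pos
  obtain ⟨hA1, hA2⟩ := abs_le.1 hA
  obtain ⟨hB1, hB2⟩ := abs_le.1 hB
  have hab : γ / 2 ≤ a - b := by linarith
  -- `ξ² ≤ h²/4`
  have he : |b - (-μ / 2 - a)| ≤ h / 4 := hB.trans hδ₂h
  have he2 : (b - (-μ / 2 - a)) ^ 2 ≤ (h / 4) ^ 2 := by
    rw [← sq_abs]; exact pow_le_pow_left₀ (abs_nonneg _) he 2
  have hξ : (-2 * (a + b) - μ) ^ 2 ≤ h ^ 2 / 4 := by
    have e : -2 * (a + b) - μ = -2 * (b - (-μ / 2 - a)) := by ring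
    rw [e]; nlinarith
  -- `(a - b)² ≤ 4`
  have hφ : |a - b| ≤ 2 := (abs_sub a b).trans (by linarith)
  have hφ2 : (a - b) ^ 2 ≤ 4 := by
    have := pow_le_pow_left₀ (abs_nonneg _) hφ 2
    rw [sq_abs] at this; linarith
  set u : ℝ := (-2 * (a + b) - μ) ^ 2 + 8 * (a - b) ^ 2 * h ^ 2 with hu
  have hu0 : 0 ≤ u := by positivity
  have hu36 : u ≤ (6 * h) ^ 2 := by rw [hu]; nlinarith [sq_nonneg h]
  have h6h : 0 < 6 * h := by positivity
  have hβ6h : 4 * π ≤ β * (6 * h) := by nlinarith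
  have hS2 : β / (16 * π * (6 * h) ^ 3) ≤ ∑' n : ℕ, 1 / (((2 * n + 1) * π / β) ^ 2 + u) ^ 2 :=
    (fam_matsubara_S2_lower hβ h6h hβ6h).trans (fam_S2_antitone hβ hu0 hu36)
  have hφ4 : (γ / 2) ^ 4 ≤ (a - b) ^ 4 := pow_le_pow_left₀ (by positivity) hab 4
  exact mul_le_mul hφ4 hS2 (by positivity) (by positivity)

/-- **The antinodal shell carries the margin.** For `μ ∈ [μ₁, μ₂] ⊂ (-4, 0)`, `γ = 1 + μ₁/4`, `h ∈ [h₀, 3]`,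
`βh ≥ 4π` and `L ≥ 16π/γ`, `L ≥ 8π/min(h₀,γ)`: the double momentum sum of `ĝ_d⁴ · S₂(E²)` is at least
`(γL/16π) · (min(h,γ)L/8π) · (γ/2)⁴β/(16π(6h)³)` (count of the shell `cos k₁ ∈ [½−μ/8 ± γ/8]`,
`cos k₂ ∈ [−μ/2 − cos k₁ ± min(h,γ)/4]` times the per-momentum bound `fam_boxTerm_lower`). [folklore] -/
theorem fam_shellSum_lower {μ₁ μ₂ μ γ β h h₀ : ℝ} {L : ℕ} (hγ_def : γ = 1 + μ₁ / 4) (hμ₁ : -4 < μ₁)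
    (hμ₂ : μ₂ < 0) (hμ : μ ∈ Set.Icc μ₁ μ₂) (hβ : 0 < β) (hh₀ : 0 < h₀) (hh : h ∈ Set.Icc h₀ 3)
    (hβh : 4 * π ≤ β * h) (hLpos : 0 < L) (hL1 : 16 * π / γ ≤ L) (hL2 : 8 * π / min h₀ γ ≤ L) :
    (γ / 8 * L / (2 * π)) * (min h γ / 4 * L / (2 * π)) * ((γ / 2) ^ 4 * (β / (16 * π * (6 * h) ^ 3))) ≤
      ∑ i ∈ Finset.range L, ∑ j ∈ Finset.range L,
        (Real.cos (2 * π * i / L) - Real.cos (2 * π * j / L)) ^ 4 *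
          ∑' n : ℕ, 1 / (((2 * n + 1) * π / β) ^ 2 +
            ((-2 * (Real.cos (2 * π * i / L) + Real.cos (2 * π * j / L)) - μ) ^ 2 +
              8 * (Real.cos (2 * π * i / L) - Real.cos (2 * π * j / L)) ^ 2 * h ^ 2)) ^ 2 := by
  have hπ := Real.pi_pos
  obtain ⟨hμl, hμu⟩ := hμ
  obtain ⟨hhl, hhu⟩ := hh
  have hγ0 : 0 < γ := by rw [hγ_def]; linarith
  have hγ1 : γ < 1 := by rw [hγ_def]; linarith
  have hh0 : 0 < h := hh₀.trans_le hhl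
  have hL' : (0 : ℝ) < L := by exact_mod_cast hLpos
  have hmin0 : 0 < min h₀ γ := lt_min hh₀ hγ0
  have hminh : 0 < min h γ := lt_min hh0 hγ0
  -- the summand and the shell
  set F : ℕ → ℕ → ℝ := fun i j =>
    (Real.cos (2 * π * i / L) - Real.cos (2 * π * j / L)) ^ 4 *
      ∑' n : ℕ, 1 / (((2 * n + 1) * π / β) ^ 2 +
        ((-2 * (Real.cos (2 * π * i / L) + Real.cos (2 * π * j / L)) - μ) ^ 2 +
          8 * (Real.cos (2 * π * i / L) - Real.cos (2 * π * j / L)) ^ 2 * h ^ 2)) ^ 2 with hF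
  show _ ≤ ∑ i ∈ Finset.range L, ∑ j ∈ Finset.range L, F i j
  set A : ℝ := 1 / 2 - μ / 8 with hA
  set δ₁ : ℝ := γ / 8 with hδ₁
  set δ₂ : ℝ := min h γ / 4 with hδ₂
  have hδ₂h : δ₂ ≤ h / 4 := by rw [hδ₂]; linarith [min_le_left h γ]
  have hδ₂γ : δ₂ ≤ γ / 4 := by rw [hδ₂]; linarith [min_le_right h γ]
  have hδ₂0 : 0 < δ₂ := by rw [hδ₂]; positivity
  have hγμ : γ ≤ 1 + μ / 4 := by rw [hγ_def]; linarith
  set I : Finset ℕ := (Finset.range L).filter fun i : ℕ =>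
    A - δ₁ ≤ Real.cos (2 * π * i / L) ∧ Real.cos (2 * π * i / L) ≤ A + δ₁ with hI
  set J : ℕ → Finset ℕ := fun i => (Finset.range L).filter fun j : ℕ =>
    (-μ / 2 - Real.cos (2 * π * i / L)) - δ₂ ≤ Real.cos (2 * π * j / L) ∧
      Real.cos (2 * π * j / L) ≤ (-μ / 2 - Real.cos (2 * π * i / L)) + δ₂ with hJ
  set m : ℝ := (γ / 2) ^ 4 * (β / (16 * π * (6 * h) ^ 3)) with hm
  have hm0 : 0 ≤ m := by positivity
  have hF0 : ∀ i j, 0 ≤ F i j := fun i j => by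
    simp only [hF]
    exact mul_nonneg (by positivity) (fam_S2_nonneg _ _)
  -- per-momentum bound on the shell
  have hFbox : ∀ i ∈ I, ∀ j ∈ J i, m ≤ F i j := by
    intro i hi j hj
    simp only [hI, Finset.mem_filter] at hi
    simp only [hJ, Finset.mem_filter] at hj
    have hAi : |Real.cos (2 * π * i / L) - (1 / 2 - μ / 8)| ≤ γ / 8 := by
      rw [abs_sub_le_iff]; constructor <;> linarith [hi.2.1, hi.2.2]
    have hBj : |Real.cos (2 * π * j / L) - (-μ / 2 - Real.cos (2 * π * i / L))| ≤ δ₂ := by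
      rw [abs_sub_le_iff]; constructor <;> linarith [hj.2.1, hj.2.2]
    exact fam_boxTerm_lower hβ hh0 hβh hγ0 hγμ hδ₂h hδ₂γ hAi hBj (Real.abs_cos_le_one _) (Real.abs_cos_le_one _)
  -- the count of `I`
  have hA_lo : -1 ≤ A - δ₁ := by rw [hA, hδ₁]; linarith
  have hA_hi : A + δ₁ ≤ 1 := by rw [hA, hδ₁, hγ_def]; linarith
  have hIcard : δ₁ * L / (2 * π) ≤ (I.card : ℝ) := by
    have h1 := fam_card_cos_Icc hLpos hA_lo (by linarith) hA_hi
    have h2 : 1 ≤ δ₁ * L / (2 * π) := by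
      rw [le_div_iff₀ (by positivity), hδ₁]
      have := (div_le_iff₀ hγ0).1 hL1
      linarith
    have h3 : (A + δ₁ - (A - δ₁)) * L / (2 * π) - 1 = 2 * (δ₁ * L / (2 * π)) - 1 := by ring
    rw [h3] at h1
    linarith
  -- the count of `J i`
  have hJcard : ∀ i ∈ I, δ₂ * L / (2 * π) ≤ ((J i).card : ℝ) := by
    intro i hi
    simp only [hI, Finset.mem_filter] at hi
    have hy_hi : (-μ / 2 - Real.cos (2 * π * i / L)) + δ₂ ≤ 1 := by
      rw [hA, hδ₁, hγ_def] at hi; linarith [hi.2.1]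
    have hy_lo : -1 ≤ (-μ / 2 - Real.cos (2 * π * i / L)) - δ₂ := by
      rw [hA, hδ₁] at hi; linarith [hi.2.2]
    have h1 := fam_card_cos_Icc hLpos hy_lo (by linarith) hy_hi
    have h2 : 1 ≤ δ₂ * L / (2 * π) := by
      rw [le_div_iff₀ (by positivity)]
      have h3 := (div_le_iff₀ hmin0).1 hL2
      have h4 : min h₀ γ ≤ min h γ := min_le_min hhl le_rfl
      have h5 : min h₀ γ * L ≤ min h γ * L := by gcongr
      rw [hδ₂]; linarith
    have h3 : ((-μ / 2 - Real.cos (2 * π * i / L)) + δ₂ - ((-μ / 2 - Real.cos (2 * π * i / L)) - δ₂)) * L / (2 * π) - 1 =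
        2 * (δ₂ * L / (2 * π)) - 1 := by ring
    rw [h3] at h1
    have h4 : 2 * (δ₂ * L / (2 * π)) - 1 ≤ ((J i).card : ℝ) := by simpa only [hJ] using h1
    linarith
  -- the chain
  have hJsub : ∀ i, J i ⊆ Finset.range L := fun i => by simp only [hJ]; exact Finset.filter_subset _ _
  have hIsub : I ⊆ Finset.range L := by simp only [hI]; exact Finset.filter_subset _ _
  calc δ₁ * L / (2 * π) * (δ₂ * L / (2 * π)) * m
      = δ₁ * L / (2 * π) * (δ₂ * L / (2 * π) * m) := by ring
    _ ≤ (I.card : ℝ) * (δ₂ * L / (2 * π) * m) := mul_le_mul_of_nonneg_right hIcard (by positivity)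
    _ = ∑ _i ∈ I, δ₂ * L / (2 * π) * m := by rw [Finset.sum_const, nsmul_eq_mul]
    _ ≤ ∑ i ∈ I, ((J i).card : ℝ) * m := Finset.sum_le_sum fun i hi => mul_le_mul_of_nonneg_right (hJcard i hi) hm0
    _ = ∑ i ∈ I, ∑ _j ∈ J i, m := Finset.sum_congr rfl fun i _ => by rw [Finset.sum_const, nsmul_eq_mul]
    _ ≤ ∑ i ∈ I, ∑ j ∈ J i, F i j := Finset.sum_le_sum fun i hi => Finset.sum_le_sum fun j hj => hFbox i hi j hj
    _ ≤ ∑ i ∈ I, ∑ j ∈ Finset.range L, F i j :=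
        Finset.sum_le_sum fun i _ => Finset.sum_le_sum_of_subset_of_nonneg (hJsub i) fun j _ _ => hF0 i j
    _ ≤ ∑ i ∈ Finset.range L, ∑ j ∈ Finset.range L, F i j :=
        Finset.sum_le_sum_of_subset_of_nonneg hIsub fun i _ _ => Finset.sum_nonneg fun j _ => hF0 i j

/-- **The free anomalous margin (quantitative `U = 0` signal of DEEP-SIGN), uniformly in the volume.**
For every window `-4 < μ₁ < μ₂ < 0` there is `c > 0` (here `c = γ⁶/(165888π³)`, `γ = 1 + μ₁/4`) such that for
every `h₀ > 0` there is `L₀` with: for all `L ≥ L₀`, `β > 0`, `μ ∈ [μ₁, μ₂]`, `h ∈ [h₀, 3]` with `βh ≥ 4π`,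

  `c · L²/β ≤ (Re⟨Δ_d⟩_{β,H})² − Re (Δ_d,Δ_d)_{Duh; β, H}`,  `H = dWaveSourceTorus L 0 μ h`.

In the Ward currency of `TransverseWardIdentity.lean` this is `χ⊥ − χ∥ ≥ 4c` for the free sourced BdG gas, an
`h`-independent gap at all deep sources; the stub `stub_fvDeepAnomalousSign` at `U = 0` with a MARGIN
(`cal_freeAnomalousSign_finiteVolume` is the bare sign). [folklore] -/
theorem fam_freeAnomalousMargin :
    ∀ (μ₁ μ₂ : ℝ), -4 < μ₁ → μ₁ < μ₂ → μ₂ < 0 → ∃ c : ℝ, 0 < c ∧ ∀ (h₀ : ℝ), 0 < h₀ → ∃ L₀ : ℕ,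
    ∀ (L : ℕ) [NeZero L], L₀ ≤ L → ∀ (β : ℝ), 0 < β → ∀ μ ∈ Set.Icc μ₁ μ₂, ∀ h ∈ Set.Icc h₀ 3,
    4 * Real.pi ≤ β * h → c * (L : ℝ) ^ 2 / β ≤ (Matrix.gibbsState β
    (Literature.MathematicalPhysics.QuantumLattice.dWaveSourceTorus L 0 μ h)
    (Literature.MathematicalPhysics.QuantumLattice.pairField
    Literature.MathematicalPhysics.QuantumLattice.dWaveFormFactor L)).re ^ 2 - (Matrix.duhamel β
    (Literature.MathematicalPhysics.QuantumLattice.dWaveSourceTorus L 0 μ h)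
    (Literature.MathematicalPhysics.QuantumLattice.pairField
    Literature.MathematicalPhysics.QuantumLattice.dWaveFormFactor L)
    (Literature.MathematicalPhysics.QuantumLattice.pairField
    Literature.MathematicalPhysics.QuantumLattice.dWaveFormFactor L)).re := by
  intro μ₁ μ₂ hμ₁ hμ₁₂ hμ₂
  have hπ := Real.pi_pos
  set γ : ℝ := 1 + μ₁ / 4 with hγ_def
  have hγ0 : 0 < γ := by rw [hγ_def]; linarith
  have hγ1 : γ < 1 := by rw [hγ_def]; linarith
  refine ⟨γ ^ 6 / (165888 * π ^ 3), by positivity, ?_⟩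
  intro h₀ hh₀
  have hmin0 : 0 < min h₀ γ := lt_min hh₀ hγ0
  refine ⟨max 3 (⌈16 * π / γ⌉₊ + ⌈8 * π / min h₀ γ⌉₊), ?_⟩
  intro L _ hL β hβ μ hμ h hh hβh
  have hL3 : 3 ≤ L := le_trans (le_max_left _ _) hL
  have hLsum : ⌈16 * π / γ⌉₊ + ⌈8 * π / min h₀ γ⌉₊ ≤ L := le_trans (le_max_right _ _) hL
  have hLpos : 0 < L := lt_of_lt_of_le (by norm_num) hL3
  have hL1 : 16 * π / γ ≤ L := by
    have h1 : (⌈16 * π / γ⌉₊ : ℝ) ≤ L := by exact_mod_cast le_trans (Nat.le_add_right _ _) hLsum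
    exact (Nat.le_ceil _).trans h1
  have hL2 : 8 * π / min h₀ γ ≤ L := by
    have h1 : (⌈8 * π / min h₀ γ⌉₊ : ℝ) ≤ L := by exact_mod_cast le_trans (Nat.le_add_left _ _) hLsum
    exact (Nat.le_ceil _).trans h1
  have hh0 : 0 < h := hh₀.trans_le hh.1
  have hL' : (0 : ℝ) < L := by exact_mod_cast hLpos
  rw [fam_freeAnomalousMargin_eq β μ hβ L hL3 h hh0, fam_doubleSum_eq]
  have hS := fam_shellSum_lower hγ_def hμ₁ hμ₂ hμ hβ hh₀ hh hβh hLpos hL1 hL2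
  have hmin : γ * h ≤ 3 * min h γ := by
    rcases le_total h γ with hle | hle
    · rw [min_eq_left hle]; nlinarith
    · rw [min_eq_right hle]; nlinarith [hh.2]
  have hβ0 : β ≠ 0 := hβ.ne'
  have hh0' : h ≠ 0 := hh0.ne'
  have hπ0 : π ≠ 0 := hπ.ne'
  have hγ0' : γ ≠ 0 := hγ0.ne'
  have eL : γ ^ 6 / (165888 * π ^ 3) * (L : ℝ) ^ 2 / β =
      γ ^ 5 * (L : ℝ) ^ 2 / (55296 * π ^ 3 * β * h) * (γ * h / 3) := by
    field_simp; ring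
  have eR : 128 * h ^ 2 / β ^ 2 *
      (γ / 8 * L / (2 * π) * (min h γ / 4 * L / (2 * π)) * ((γ / 2) ^ 4 * (β / (16 * π * (6 * h) ^ 3)))) =
      γ ^ 5 * (L : ℝ) ^ 2 / (55296 * π ^ 3 * β * h) * min h γ := by
    field_simp; ring
  calc γ ^ 6 / (165888 * π ^ 3) * (L : ℝ) ^ 2 / β
      = γ ^ 5 * (L : ℝ) ^ 2 / (55296 * π ^ 3 * β * h) * (γ * h / 3) := eL
    _ ≤ γ ^ 5 * (L : ℝ) ^ 2 / (55296 * π ^ 3 * β * h) * min h γ :=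
        mul_le_mul_of_nonneg_left (by linarith) (by positivity)
    _ = 128 * h ^ 2 / β ^ 2 *
        (γ / 8 * L / (2 * π) * (min h γ / 4 * L / (2 * π)) * ((γ / 2) ^ 4 * (β / (16 * π * (6 * h) ^ 3)))) := eR.symm
    _ ≤ _ := mul_le_mul_of_nonneg_left hS (by positivity)

end Summit.HubbardSuperconductivity.HubbardSuperconductivity.Theorems.TwSeededEnsembleEquivalenceR
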